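import Literature.AlgebraicGeometry.HodgeTheory.FermatInductiveClaimsLiteralForms
import HarnessLib

/-!
# `Shioda_claim_paired` from Thm. 1-4 (i): the paired characters are juxtapositions of pairs

Family `hodge`, layer `Literature/AlgebraicGeometry/HodgeTheory`. Proof file (everything PROVED, no
named fact introduced) recording the DEPENDENCY between two named facts of `FermatInductiveClaims`:
**`Aoki1987_claim_juxtaposition` (Aoki 1987 Thm. 1-4 (i) = Shioda's inductive structure of type I,
Math. Ann. 245 (1979) Thm. I; Ran, Compositio Math. 42 (1980) Cor. 4.7) implies
`Shioda_claim_paired` (Thm. 1-1's claim(δ) for `δ ∈ 𝔇ⁿₘ`).** This is Ran's road to the linear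
spaces (Thm. 4.9: "if `m` is prime, the Hodge subspace is generated by the homology classes of
linear spaces" — proof of Prop. 4.6: "for `n′ = n″ = 0` … a basis for `P₀(V⁰ₘ)` is given by
`pᵢ - p₀`", and `H_{χ′} ∗ H_{χ″} = H_{χ′∗χ″}`, Cor. 4.7; the `∗`-product of points is a linear
space): Aoki's `δ = (a₀, -a₀, …, a_r, -a_r)` (`FermatCharacter.standardPaired a`, file
`FermatInductiveClaimsLiteralForms`) is the juxtaposition `(a₀, -a₀, …, a_{r-1}, -a_{r-1}) ∗ (a_r, -a_r)`
UP TO THE MULTISET OF VALUES (`FermatCharacter.univ_val_map_standardPaired`), each factor is a Hodge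
character (`IsPaired.isHodge`), and claim holds trivially in dimension `0` (`X⁰ₘ` is `m` points:
`FermatCharacter.claim_zero`, `algebraicClasses _ 0 = ⊤`); so Thm. 1-4 (i), applied `r` times,
gives claim(`(a₀, -a₀, …, a_r, -a_r)`) (`FermatCharacter.claim_standardPaired_of_juxtaposition`),
whence `Shioda_claim_paired` by permutation invariance (the tree's
`Shioda_claim_paired_of_standardPaired`): `Shioda_claim_paired_of_juxtaposition`.

Consequently `Shioda_claim_paired_holds` will follow at once from
`Aoki1987_claim_juxtaposition_holds`; the direct road (the cycle class of the linear space `L` and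
`ω_δ(L) ≠ 0`, Thm. 1-1 proper) is `ShiodaClaimPairedProofs` / `FermatLinearSubspaceClass`.

## References

* [Aoki1987] N. Aoki, Some new algebraic cycles on Fermat varieties, J. Math. Soc. Japan 39 (1987)
  385–396: Thm. 1-4 (i) (p. 388), Thm. 1-1 and §1 pp. 386–387 (`𝔇ⁿₘ`) (text read, J-STAGE copy).
* [Ran1980] Z. Ran, Cycles on Fermat hypersurfaces, Compositio Math. 42 (1980) 121–142: proof of
  Prop. 4.6 (p. 140), Cor. 4.7, Thm. 4.9 (p. 141) (text read, numdam).
-/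

noncomputable section

open Finset

namespace Literature.AlgebraicGeometry.HodgeTheory

namespace FermatCharacter

variable {m r : ℕ}

/-! ### The multiset of values of `(a₀, -a₀, …, a_r, -a_r)` -/

/-- The multiset of values of a tuple is the sum of the singletons of its values. [folklore] -/
theorem univ_val_map_eq_sum_singleton {K : ℕ} {X : Type*} (x : Fin K → X) :
    univ.val.map x = ∑ i, ({x i} : Multiset X) := by
  have h := map_sum (Multiset.mapAddMonoidHom x) (fun i : Fin K ↦ ({i} : Multiset (Fin K))) univ
  simp only [Multiset.coe_mapAddMonoidHom, Multiset.map_singleton] at h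
  rw [← h, sum_multiset_singleton]

/-- **The multiset of values of `(a₀, -a₀, …, a_r, -a_r)` is `{a₀, …, a_r} + {-a₀, …, -a_r}`**
(coordinate `2j` carries `a_j`, coordinate `2j + 1` carries `-a_j`). [cite: Aoki1987, §1 p. 386] -/
theorem univ_val_map_standardPaired (a : Fin (r + 1) → ZMod m) :
    univ.val.map (standardPaired a) = univ.val.map a + univ.val.map (fun j ↦ -a j) := by
  rw [univ_val_map_eq_sum_singleton, univ_val_map_eq_sum_singleton, univ_val_map_eq_sum_singleton,
    ← Finset.sum_add_distrib, ← Equiv.sum_comp pairIndexEquiv, Fintype.sum_prod_type]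
  refine Finset.sum_congr rfl fun j _ ↦ ?_
  rw [Fin.sum_univ_two, pairIndexEquiv_apply, pairIndexEquiv_apply, standardPaired_pairIndex_zero,
    standardPaired_pairIndex_one]

/-- The multiset of values of a tuple on `Fin (k + 1)` is that of its initial segment plus its last
value. [folklore] -/
theorem univ_val_map_eq_init_add {X : Type*} {k : ℕ} (x : Fin (k + 1) → X) :
    univ.val.map x = univ.val.map (Fin.init x) + {x (Fin.last k)} := by
  rw [Fin.univ_val_map, Fin.univ_val_map, List.ofFn_succ']
  simp only [List.concat_eq_append, ← Multiset.coe_add, Multiset.coe_singleton]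
  rfl

/-- **`(a₀, -a₀, …, a_{r+1}, -a_{r+1}) ∼ (a₀, -a₀, …, a_r, -a_r) ∗ (a_{r+1}, -a_{r+1})`**: equality of the
multisets of values (Aoki's "`δ ∈ 𝔇ⁿₘ` is a juxtaposition of elements of `𝔇⁰ₘ`").
[cite: Aoki1987, §1 pp. 386–387] -/
theorem univ_val_map_standardPaired_succ (a : Fin (r + 2) → ZMod m) :
    univ.val.map (standardPaired a) =
      univ.val.map (standardPaired (Fin.init a)) +
        univ.val.map (standardPaired (fun _ : Fin (0 + 1) ↦ a (Fin.last (r + 1)))) := by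
  rw [univ_val_map_standardPaired, univ_val_map_standardPaired, univ_val_map_standardPaired,
    univ_val_map_eq_init_add a, univ_val_map_eq_init_add (fun j ↦ -a j)]
  have h1 : univ.val.map (fun _ : Fin (0 + 1) ↦ a (Fin.last (r + 1))) = {a (Fin.last (r + 1))} := rfl
  have h2 : univ.val.map (fun j : Fin (0 + 1) ↦ -(fun _ : Fin (0 + 1) ↦ a (Fin.last (r + 1))) j) =
      {-a (Fin.last (r + 1))} := rfl
  rw [h1, h2]
  change univ.val.map (Fin.init a) + {a (Fin.last (r + 1))} +
      (univ.val.map (Fin.init fun j ↦ -a j) + {-a (Fin.last (r + 1))}) =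
    univ.val.map (Fin.init a) + univ.val.map (fun j ↦ -Fin.init a j) +
      ({a (Fin.last (r + 1))} + {-a (Fin.last (r + 1))})
  have h3 : (Fin.init fun j ↦ -a j) = fun j ↦ -Fin.init a j := rfl
  rw [h3]
  abel

/-! ### claim(`(a₀, -a₀, …, a_r, -a_r)`) from Thm. 1-4 (i) by induction on `r` -/

/-- **Thm. 1-4 (i) ⟹ claim(`(a₀, -a₀, …, a_r, -a_r)`)** for all `a_j ≠ 0`, by induction on `r`:
in dimension `0` claim is trivial (`claim_zero`); and
`(a₀, -a₀, …, a_{r+1}, -a_{r+1}) ∼ (a₀, …, -a_r) ∗ (a_{r+1}, -a_{r+1})` is a juxtaposition of two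
PAIRED, hence Hodge (`IsPaired.isHodge`), characters for which claim holds by induction, so
`Aoki1987_claim_juxtaposition` (juxtaposition up to the multiset of values) applies. Ran's proof
of Prop. 4.6 / Cor. 4.7 from the points of `X⁰ₘ`. [cite: Aoki1987, Thm. 1-4 (i) (p. 388)]
[cite: Ran1980, proof of Prop. 4.6 and Cor. 4.7] -/
theorem claim_standardPaired_of_juxtaposition (h : Aoki1987_claim_juxtaposition) [NeZero m] :
    ∀ (r : ℕ) (a : Fin (r + 1) → ZMod m), (∀ j, a j ≠ 0) → Claim m r (standardPaired a) := by
  intro r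
  induction r with
  | zero => exact fun a _ ↦ FermatCharacter.claim_zero m _
  | succ r ih =>
    intro a ha
    have hα : IsHodge (standardPaired (Fin.init a)) :=
      (isPaired_standardPaired _).isHodge (standardPaired_ne_zero fun j ↦ ha _)
    have hβ : IsHodge (standardPaired (fun _ : Fin (0 + 1) ↦ a (Fin.last (r + 1)))) :=
      (isPaired_standardPaired _).isHodge (standardPaired_ne_zero fun _ ↦ ha _)
    exact h m r 0 (standardPaired (Fin.init a)) (standardPaired fun _ : Fin (0 + 1) ↦ a (Fin.last (r + 1)))
      (standardPaired a) hα hβ (univ_val_map_standardPaired_succ a) (ih _ fun j ↦ ha _)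
      (FermatCharacter.claim_zero m _)

end FermatCharacter

/-! ### The dependency between the two named facts -/

/-- **`Aoki1987_claim_juxtaposition ⟹ Shioda_claim_paired`** (Thm. 1-4 (i) implies Thm. 1-1's
claim(δ), `δ ∈ 𝔇ⁿₘ`): every paired character is `(a₀, -a₀, …, a_r, -a_r)` up to a permutation of
the coordinates, claim is invariant under permutations (the tree's
`Shioda_claim_paired_of_standardPaired`), and claim(`(a₀, -a₀, …, a_r, -a_r)`) follows from
Thm. 1-4 (i) by `FermatCharacter.claim_standardPaired_of_juxtaposition`. Hence
`Shioda_claim_paired_holds` is a one-line consequence of `Aoki1987_claim_juxtaposition_holds`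
(Ran Thm. 4.9: the Hodge classes generated by `∗`-products of points are the classes of linear
spaces). [cite: Ran1980, Thm. 4.9 and Cor. 4.7] [cite: Aoki1987, Thm. 1-4 (i) and Thm. 1-1] -/
theorem Shioda_claim_paired_of_juxtaposition (h : Aoki1987_claim_juxtaposition) : Shioda_claim_paired :=
  Shioda_claim_paired_of_standardPaired fun _ r _ a ha ↦
    FermatCharacter.claim_standardPaired_of_juxtaposition h r a ha

end Literature.AlgebraicGeometry.HodgeTheory

end
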